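import Summits.ResolutionOfSingularities.ResolutionOfSingularities.Theorems.RadicialJungCleanModelsSufficeChartsKummer
import Literature.AlgebraicGeometry.Resolution.NormalizationInExtension
import Mathlib.AlgebraicGeometry.FunctionField

/-!
# Route `RadicialJung`, crux `CleanModelsSuffice`, line `Sketch`: the adapted log-clean data,
# bundled, and the normalised toroidal data at a point

Helper for the registered stub `stub_charts` of the skeleton of
`Summit.ResolutionOfSingularities.ResolutionOfSingularities.Theses.RadicialJung.CleanModelsSuffice`
(stmt-ResolutionOfSingularities-15883). The hypothesis `hR` of `stub_charts` (a regular model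
log-clean ADAPTED to its boundary: per point `v` a presentation `y^p = g`, a minimal system of
parameters `t`, exponents `a`, an open `U ∋ v` with boundary sections `s`, which are JOINTLY part
of a regular system wherever they vanish, and pairwise compatible on OVERLAPS) is a long
existential; this file bundles its witnesses and three properties as the structure `AdaptedData`
and derives the data the Kato charts are built from at a TOROIDAL point `v` (`0 < m v`): the
charged boundary sections `sC v` (indices `< m v`, re-indexed by `Fin (m v - 1 + 1)`), their germs
`tC v`, the exponents `aC v`, the toroidal relation `y^p = ∏ tC_i^{aC_i}`, and — applying the
hypothesis `hNorm` of `stub_charts` in the local ring `𝒪_{V,v}` — the NORMALISED generator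
`y' v` and exponents `a' v` (`a'₀ = 1`, `1 ≤ a'_i < p`, `a' ≡ c' · aC (mod p)`,
`y'^p = ∏ tC_i^{a'_i}`), together with the values `uC v i ∈ L` of the charged sections and the
relation `y'^p = ∏ uC_i^{a'_i}` in `L`. Finally the two consequences of OVERLAP used to sort
points into cases: a charged coordinate of `w` vanishing at `w` is matched by a charged section of
every chart through `w` vanishing at `w`.
-/

noncomputable section

set_option linter.dupNamespace false -- mandated namespace of this single-conjunct summit

open CategoryTheory AlgebraicGeometry TopologicalSpace
open Literature.AlgebraicGeometry.Resolution

namespace Summit.ResolutionOfSingularities.ResolutionOfSingularities.Theorems.RadicialJung.CleanModelsSuffice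

/-- **Adapted log-clean data** on `(V, L)`: the witnesses and the three properties (POINTWISE,
JOINTSOP, OVERLAP) of the hypothesis `hR` of `stub_charts`, verbatim. [folklore] -/
structure AdaptedData (p : ℕ) (V : Scheme.{0}) [IsIntegral V] (L : Type) [Field L]
    [Algebra V.functionField L] where
  /-- the generator `y v ∈ L ∖ K(V)` of the presentation at `v` -/
  y : V → L
  /-- `g v = (y v)^p ∈ K(V)` -/
  g : V → V.functionField
  /-- `d v = dim 𝒪_{V,v}` -/
  d : V → ℕ
  /-- the number of boundary components through `v` -/
  r : V → ℕ
  /-- the number of CHARGED boundary components through `v` -/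
  m : V → ℕ
  hrd : ∀ v, r v ≤ d v
  hmr : ∀ v, m v ≤ r v
  /-- a minimal system of generators of `𝔪_v` -/
  t : ∀ v : V, Fin (d v) → V.presheaf.stalk v
  /-- the exponents of the toroidal relation -/
  a : ∀ v : V, Fin (m v) → ℕ
  /-- the open on which the boundary sections live -/
  U : V → V.Opens
  hU : ∀ v, v ∈ U v
  /-- the boundary sections -/
  s : ∀ v : V, Fin (r v) → Γ(V, U v)
  /-- POINTWISE: the log-clean presentation at `v` -/
  pointwise : ∀ v : V, y v ∉ Set.range (algebraMap V.functionField L) ∧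
    algebraMap V.functionField L (g v) = y v ^ p ∧
    Ideal.span (Set.range (t v)) = IsLocalRing.maximalIdeal (V.presheaf.stalk v) ∧
    ringKrullDim (V.presheaf.stalk v) = (d v : WithBot ℕ∞) ∧
    (∀ i : Fin (r v), V.presheaf.germ (U v) v (hU v) (s v i) = t v (Fin.castLE (hrd v) i)) ∧
    (∀ i : Fin (m v), ¬ p ∣ a v i) ∧
    ((0 < m v ∧ g v = ∏ i : Fin (m v),
        (algebraMap (V.presheaf.stalk v) V.functionField
          (t v (Fin.castLE ((hmr v).trans (hrd v)) i))) ^ (a v i)) ∨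
      (m v = 0 ∧ ∃ u₀ : V.presheaf.stalk v, IsUnit u₀ ∧
        g v = algebraMap (V.presheaf.stalk v) V.functionField u₀ ∧
        ((∀ x : V.presheaf.stalk v, u₀ - x ^ p ∉ IsLocalRing.maximalIdeal (V.presheaf.stalk v)) ∨
          (∃ x : V.presheaf.stalk v, u₀ - x ^ p ∈ IsLocalRing.maximalIdeal (V.presheaf.stalk v) ∧
            u₀ - x ^ p ∉ IsLocalRing.maximalIdeal (V.presheaf.stalk v) ^ 2 ⊔
              Ideal.span (Set.range fun i : Fin (r v) => t v (Fin.castLE (hrd v) i))))))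
  /-- JOINTSOP: the boundary sections of `v` vanishing at `w ∈ U v` are jointly part of a minimal
  system of generators of `𝔪_w` -/
  jointSop : ∀ (v w : V) (hw : w ∈ U v), ∃ (dw : ℕ) (tw : Fin dw → V.presheaf.stalk w)
    (ι : Fin (r v) → Fin dw),
    Ideal.span (Set.range tw) = IsLocalRing.maximalIdeal (V.presheaf.stalk w) ∧
    ringKrullDim (V.presheaf.stalk w) = (dw : WithBot ℕ∞) ∧
    (∀ i : Fin (r v), V.presheaf.germ (U v) w hw (s v i) ∈
        IsLocalRing.maximalIdeal (V.presheaf.stalk w) →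
      tw (ι i) = V.presheaf.germ (U v) w hw (s v i)) ∧
    (∀ i j : Fin (r v), V.presheaf.germ (U v) w hw (s v i) ∈
        IsLocalRing.maximalIdeal (V.presheaf.stalk w) →
      V.presheaf.germ (U v) w hw (s v j) ∈ IsLocalRing.maximalIdeal (V.presheaf.stalk w) →
      ι i = ι j → i = j)
  /-- OVERLAP: two charts through `w` have associated boundary parameters at `w`, with the same
  charged-ness and proportional exponents -/
  overlap : ∀ (v v' w : V) (hw : w ∈ U v) (hw' : w ∈ U v'), ∃ μ : ℕ, ¬ p ∣ μ ∧ ∀ i : Fin (r v),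
    V.presheaf.germ (U v) w hw (s v i) ∈ IsLocalRing.maximalIdeal (V.presheaf.stalk w) →
    ∃ i' : Fin (r v'), Associated (V.presheaf.germ (U v) w hw (s v i))
        (V.presheaf.germ (U v') w hw' (s v' i')) ∧
      ((i : ℕ) < m v ↔ (i' : ℕ) < m v') ∧
      (∀ (hi : (i : ℕ) < m v) (hi' : (i' : ℕ) < m v'), a v' ⟨i', hi'⟩ ≡ μ * a v ⟨i, hi⟩ [MOD p])

namespace AdaptedData

variable {p : ℕ} {V : Scheme.{0}} [IsIntegral V] {L : Type} [Field L] [Algebra V.functionField L]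
variable (D : AdaptedData p V L)

/-- The opens `U v` are non-empty (they contain `v`). [folklore] -/
instance nonempty_U (v : V) : Nonempty (D.U v) :=
  ⟨⟨v, D.hU v⟩⟩

/-! ## The charged boundary data at a toroidal point -/

/-- `m v - 1 + 1 = m v` at a toroidal point. [folklore] -/
theorem sub_one_add_one {v : V} (hm : 0 < D.m v) : D.m v - 1 + 1 = D.m v :=
  Nat.sub_add_cancel hm

/-- The charged indices `i < m v` inside `Fin (r v)`. [folklore] -/
def cidx (v : V) (hm : 0 < D.m v) (i : Fin (D.m v - 1 + 1)) : Fin (D.r v) :=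
  Fin.castLE ((D.sub_one_add_one hm).le.trans (D.hmr v)) i

/-- `cidx` preserves the underlying natural number. [folklore] -/
@[simp] theorem coe_cidx (v : V) (hm : 0 < D.m v) (i : Fin (D.m v - 1 + 1)) :
    ((D.cidx v hm i : Fin (D.r v)) : ℕ) = i :=
  rfl

/-- `cidx` is injective. [folklore] -/
theorem cidx_injective (v : V) (hm : 0 < D.m v) : Function.Injective (D.cidx v hm) :=
  Fin.castLE_injective ((D.sub_one_add_one hm).le.trans (D.hmr v))

/-- The CHARGED boundary sections `s_i`, `i < m v`. [folklore] -/
def sC (v : V) (hm : 0 < D.m v) (i : Fin (D.m v - 1 + 1)) : Γ(V, D.U v) :=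
  D.s v (D.cidx v hm i)

/-- Their germs at `v`, `tC_i = t_i`. [folklore] -/
def tC (v : V) (hm : 0 < D.m v) (i : Fin (D.m v - 1 + 1)) : V.presheaf.stalk v :=
  D.t v (Fin.castLE (D.hrd v) (D.cidx v hm i))

/-- The charged exponents. [folklore] -/
def aC (v : V) (hm : 0 < D.m v) (i : Fin (D.m v - 1 + 1)) : ℕ :=
  D.a v (Fin.cast (D.sub_one_add_one hm) i)

/-- `germ_v (sC_i) = tC_i`. [folklore] -/
theorem germ_sC (v : V) (hm : 0 < D.m v) (i : Fin (D.m v - 1 + 1)) :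
    V.presheaf.germ (D.U v) v (D.hU v) (D.sC v hm i) = D.tC v hm i :=
  (D.pointwise v).2.2.2.2.1 _

/-- The `tC_i` lie in `𝔪_v`. [folklore] -/
theorem tC_mem (v : V) (hm : 0 < D.m v) (i : Fin (D.m v - 1 + 1)) :
    D.tC v hm i ∈ IsLocalRing.maximalIdeal (V.presheaf.stalk v) := by
  rw [← (D.pointwise v).2.2.1]
  exact Ideal.subset_span ⟨_, rfl⟩

/-- The charged exponents are prime to `p`. [folklore] -/
theorem not_dvd_aC (v : V) (hm : 0 < D.m v) (i : Fin (D.m v - 1 + 1)) : ¬ p ∣ D.aC v hm i :=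
  (D.pointwise v).2.2.2.2.2.1 _

/-- **The toroidal relation** `g v = ∏ tC_i^{aC_i}` at a toroidal point. [folklore] -/
theorem g_eq_prod (v : V) (hm : 0 < D.m v) :
    D.g v = algebraMap (V.presheaf.stalk v) V.functionField (∏ i, D.tC v hm i ^ D.aC v hm i) := by
  rcases (D.pointwise v).2.2.2.2.2.2 with ⟨-, hg⟩ | ⟨h0, -⟩
  · rw [hg, map_prod]
    simp only [map_pow]
    exact (Fintype.prod_equiv (finCongr (D.sub_one_add_one hm)).symm _ _ fun i => rfl)
  · omega

/-- **`y^p = ∏ tC_i^{aC_i}` in `L`** at a toroidal point. [folklore] -/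
theorem y_pow (v : V) (hm : 0 < D.m v) [Algebra (V.presheaf.stalk v) L]
    [IsScalarTower (V.presheaf.stalk v) V.functionField L] :
    D.y v ^ p = algebraMap (V.presheaf.stalk v) L (∏ i, D.tC v hm i ^ D.aC v hm i) := by
  rw [← (D.pointwise v).2.1, D.g_eq_prod v hm, ← IsScalarTower.algebraMap_apply]

/-- The `tC_i` are nonzero. [folklore] -/
theorem tC_ne_zero (v : V) (hm : 0 < D.m v) (hp : p.Prime) (i : Fin (D.m v - 1 + 1)) :
    D.tC v hm i ≠ 0 := by
  intro h0
  have h1 : D.g v = 0 := by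
    rw [D.g_eq_prod v hm, Finset.prod_eq_zero (Finset.mem_univ i), map_zero]
    rw [h0, zero_pow]
    exact fun h => D.not_dvd_aC v hm i (by rw [h]; exact dvd_zero p)
  have h2 : D.y v ^ p = 0 := by rw [← (D.pointwise v).2.1, h1, map_zero]
  exact (D.pointwise v).1 ⟨0, by rw [map_zero]; exact (pow_eq_zero_iff hp.ne_zero).mp h2 |>.symm⟩

/-- The charged sections are nonzero. [folklore] -/
theorem sC_ne_zero (v : V) (hm : 0 < D.m v) (hp : p.Prime) (i : Fin (D.m v - 1 + 1)) :
    D.sC v hm i ≠ 0 := fun h =>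
  D.tC_ne_zero v hm hp i (by rw [← D.germ_sC, h, map_zero])

/-- Germs of the charged sections at any point of `U v` are nonzero. [folklore] -/
theorem germ_sC_ne_zero (v : V) (hm : 0 < D.m v) (hp : p.Prime) (w : V) (hw : w ∈ D.U v)
    (i : Fin (D.m v - 1 + 1)) : V.presheaf.germ (D.U v) w hw (D.sC v hm i) ≠ 0 := by
  rw [Ne, ← map_zero (V.presheaf.germ (D.U v) w hw).hom]
  exact fun h => D.sC_ne_zero v hm hp i (germ_injective_of_isIntegral _ w hw h)

/-! ## The values in `L` of the charged sections -/

/-- The value `uC_i ∈ L` of the charged section `sC_i` (through `Γ(V, U v) → K(V) → L`).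
[folklore] -/
def uC (v : V) (hm : 0 < D.m v) (i : Fin (D.m v - 1 + 1)) : L :=
  algebraMap V.functionField L (V.germToFunctionField (D.U v) (D.sC v hm i))

/-- **The `uC_i` are the images of the germs at any point of `U v`.** [folklore] -/
theorem uC_eq_algebraMap_germ (v : V) (hm : 0 < D.m v) (w : V) (hw : w ∈ D.U v)
    [Algebra (V.presheaf.stalk w) L] [IsScalarTower (V.presheaf.stalk w) V.functionField L]
    (i : Fin (D.m v - 1 + 1)) :
    D.uC v hm i = algebraMap (V.presheaf.stalk w) L (V.presheaf.germ (D.U v) w hw (D.sC v hm i)) := by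
  rw [uC, IsScalarTower.algebraMap_apply (V.presheaf.stalk w) V.functionField L,
    Scheme.algebraMap_germ_eq_germToFunctionField]

/-- The `uC_i` are nonzero. [folklore] -/
theorem uC_ne_zero (v : V) (hm : 0 < D.m v) (hp : p.Prime) (i : Fin (D.m v - 1 + 1)) :
    D.uC v hm i ≠ 0 := by
  rw [uC, map_ne_zero_iff _ (algebraMap V.functionField L).injective]
  rw [Ne, ← map_zero (V.germToFunctionField (D.U v)).hom]
  exact fun h => D.sC_ne_zero v hm hp i (V.germToFunctionField_injective _ h)

/-! ## The normalised toroidal data (`hNorm` applied in `𝒪_{V,v}`) -/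

section Norm

variable (hNorm : ∀ {O K L : Type} [CommRing O] [IsDomain O] [Field K] [Algebra O K]
  [IsFractionRing O K] [Field L] [Algebra K L] [Algebra O L] [IsScalarTower O K L]
  (p : ℕ) (_ : p.Prime) [CharP K p] (_ : Module.finrank K L = p) (m : ℕ)
  (t : Fin (m + 1) → O) (_ : ∀ i, t i ≠ 0) (a : Fin (m + 1) → ℕ) (_ : ∀ i, ¬ p ∣ a i)
  (y : L) (_ : y ∉ Set.range (algebraMap K L))
  (_ : y ^ p = algebraMap O L (∏ i, t i ^ a i)),
  ∃ (y' : L) (a' : Fin (m + 1) → ℕ) (c : ℕ), y' ∉ Set.range (algebraMap K L) ∧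
    a' 0 = 1 ∧ (∀ i, 1 ≤ a' i ∧ a' i < p) ∧ ¬ p ∣ c ∧ (∀ i, a' i ≡ c * a i [MOD p]) ∧
    y' ^ p = algebraMap O L (∏ i, t i ^ a' i))
variable (hp : p.Prime) [CharP V.functionField p] (hdeg : Module.finrank V.functionField L = p)

include hNorm hp hdeg in
/-- **Normalising the exponents at a toroidal point** (`hNorm` in `𝒪_{V,v}`): a new generator
`y'` and exponents `a'` with `a'₀ = 1`, `1 ≤ a'_i < p`, `a' ≡ c · aC (mod p)` and
`y'^p = ∏ uC_i^{a'_i}` in `L`. [folklore] -/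
theorem exists_normalized (v : V) (hm : 0 < D.m v) :
    ∃ (y' : L) (a' : Fin (D.m v - 1 + 1) → ℕ) (c : ℕ),
      y' ∉ Set.range (algebraMap V.functionField L) ∧ a' 0 = 1 ∧ (∀ i, 1 ≤ a' i ∧ a' i < p) ∧
      ¬ p ∣ c ∧ (∀ i, a' i ≡ c * D.aC v hm i [MOD p]) ∧ y' ^ p = ∏ i, D.uC v hm i ^ a' i := by
  letI : Algebra (V.presheaf.stalk v) L :=
    ((algebraMap V.functionField L).comp (algebraMap (V.presheaf.stalk v) V.functionField)).toAlgebra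
  haveI : IsScalarTower (V.presheaf.stalk v) V.functionField L :=
    IsScalarTower.of_algebraMap_eq fun _ => rfl
  obtain ⟨y', a', c, hy', ha'0, ha', hc, hcong, hyp'⟩ := hNorm p hp hdeg (D.m v - 1) (D.tC v hm)
    (D.tC_ne_zero v hm hp) (D.aC v hm) (D.not_dvd_aC v hm) (D.y v) (D.pointwise v).1 (D.y_pow v hm)
  refine ⟨y', a', c, hy', ha'0, ha', hc, hcong, ?_⟩
  rw [hyp', map_prod]
  refine Finset.prod_congr rfl fun i _ => ?_
  rw [map_pow, ← D.germ_sC v hm i, ← D.uC_eq_algebraMap_germ v hm v (D.hU v) i]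

/-- The normalised generator `y' v`. [folklore] -/
def y' (v : V) (hm : 0 < D.m v) : L :=
  (D.exists_normalized hNorm hp hdeg v hm).choose

/-- The normalised exponents `a' v`. [folklore] -/
def a' (v : V) (hm : 0 < D.m v) : Fin (D.m v - 1 + 1) → ℕ :=
  (D.exists_normalized hNorm hp hdeg v hm).choose_spec.choose

/-- The normalising multiplier `c' v` (`a' ≡ c' aC`). [folklore] -/
def c' (v : V) (hm : 0 < D.m v) : ℕ :=
  (D.exists_normalized hNorm hp hdeg v hm).choose_spec.choose_spec.choose

/-- The properties of the normalised data. [folklore] -/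
theorem normalized_spec (v : V) (hm : 0 < D.m v) :
    D.y' hNorm hp hdeg v hm ∉ Set.range (algebraMap V.functionField L) ∧
      D.a' hNorm hp hdeg v hm 0 = 1 ∧
      (∀ i, 1 ≤ D.a' hNorm hp hdeg v hm i ∧ D.a' hNorm hp hdeg v hm i < p) ∧
      ¬ p ∣ D.c' hNorm hp hdeg v hm ∧
      (∀ i, D.a' hNorm hp hdeg v hm i ≡ D.c' hNorm hp hdeg v hm * D.aC v hm i [MOD p]) ∧
      D.y' hNorm hp hdeg v hm ^ p = ∏ i, D.uC v hm i ^ D.a' hNorm hp hdeg v hm i :=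
  (D.exists_normalized hNorm hp hdeg v hm).choose_spec.choose_spec.choose_spec

/-- `y' v ≠ 0`. [folklore] -/
theorem y'_ne_zero (v : V) (hm : 0 < D.m v) : D.y' hNorm hp hdeg v hm ≠ 0 := fun h =>
  (D.normalized_spec hNorm hp hdeg v hm).1 ⟨0, by rw [map_zero, h]⟩

/-- **`y'^p = ∏ (germ_w sC_i)^{a'_i}` through `𝒪_{V,w}`** for every `w ∈ U v`. [folklore] -/
theorem y'_pow_eq_algebraMap_germ (v : V) (hm : 0 < D.m v) (w : V) (hw : w ∈ D.U v)
    [Algebra (V.presheaf.stalk w) L] [IsScalarTower (V.presheaf.stalk w) V.functionField L] :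
    D.y' hNorm hp hdeg v hm ^ p = algebraMap (V.presheaf.stalk w) L
      (∏ i, V.presheaf.germ (D.U v) w hw (D.sC v hm i) ^ D.a' hNorm hp hdeg v hm i) := by
  rw [(D.normalized_spec hNorm hp hdeg v hm).2.2.2.2.2, map_prod]
  refine Finset.prod_congr rfl fun i _ => ?_
  rw [map_pow, D.uC_eq_algebraMap_germ v hm w hw i]

end Norm

/-! ## Sorting points: charged coordinates through `w` are seen by every chart through `w` -/

/-- **A charged coordinate of `w` is matched, in every chart `v` through `w`, by a charged
section of `v` vanishing at `w`** (OVERLAP applied to `(w, v, w)`). [folklore] -/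
theorem exists_charged_mem (w : V) (hmw : 0 < D.m w) (v : V) (hw : w ∈ D.U v) :
    ∃ i : Fin (D.r v), (i : ℕ) < D.m v ∧
      V.presheaf.germ (D.U v) w hw (D.s v i) ∈ IsLocalRing.maximalIdeal (V.presheaf.stalk w) := by
  obtain ⟨μ, -, hμ⟩ := D.overlap w v w (D.hU w) hw
  have h0 : V.presheaf.germ (D.U w) w (D.hU w) (D.s w (D.cidx w hmw 0)) ∈
      IsLocalRing.maximalIdeal (V.presheaf.stalk w) := by
    have := D.tC_mem w hmw 0
    rwa [← D.germ_sC] at this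
  obtain ⟨i', hassoc, hiff, -⟩ := hμ (D.cidx w hmw 0) h0
  refine ⟨i', hiff.mp (by simp [coe_cidx]; exact hmw), ?_⟩
  rw [IsLocalRing.mem_maximalIdeal, mem_nonunits_iff, ← hassoc.isUnit_iff, ← mem_nonunits_iff,
    ← IsLocalRing.mem_maximalIdeal]
  exact h0

/-- **Regular-type charts see only regular-type points**: if `m v = 0` then `m w = 0` for every
`w ∈ U v`. [folklore] -/
theorem m_eq_zero_of_mem (v : V) (hv : D.m v = 0) (w : V) (hw : w ∈ D.U v) : D.m w = 0 := by
  by_contra h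
  obtain ⟨i, hi, -⟩ := D.exists_charged_mem w (Nat.pos_of_ne_zero h) v hw
  omega

/-- **Case B points are of regular type**: if no charged section of the toroidal chart `v`
vanishes at `w ∈ U v`, then `m w = 0`. [folklore] -/
theorem m_eq_zero_of_forall_not_mem (v : V) (hm : 0 < D.m v) (w : V) (hw : w ∈ D.U v)
    (hB : ∀ i, V.presheaf.germ (D.U v) w hw (D.sC v hm i) ∉
      IsLocalRing.maximalIdeal (V.presheaf.stalk w)) : D.m w = 0 := by
  by_contra h
  obtain ⟨i, hi, hmem⟩ := D.exists_charged_mem w (Nat.pos_of_ne_zero h) v hw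
  have hi' : (i : ℕ) < D.m v - 1 + 1 := by rw [D.sub_one_add_one hm]; exact hi
  have heq : D.cidx v hm ⟨i, hi'⟩ = i := Fin.ext rfl
  exact hB ⟨i, hi'⟩ (by rw [sC, heq]; exact hmem)

end AdaptedData

/-- **Regular-type charts see only regular-type points** (explicit-binder form, the registered
interface of this helper file). [folklore] -/
theorem adaptedData_m_eq_zero_of_mem {p : ℕ} {V : Scheme.{0}} [IsIntegral V] {L : Type} [Field L]
    [Algebra V.functionField L] (D : AdaptedData p V L) (v : V) (hv : D.m v = 0) (w : V)
    (hw : w ∈ D.U v) : D.m w = 0 :=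
  D.m_eq_zero_of_mem v hv w hw

end Summit.ResolutionOfSingularities.ResolutionOfSingularities.Theorems.RadicialJung.CleanModelsSuffice

end
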